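import Mathlib.RingTheory.Filtration
import Mathlib.RingTheory.Noetherian.Orzech
import Literature.AlgebraicGeometry.Motives.AbelianVarietyTorsion
import HarnessLib

/-!
# Multiplication by `n` on an abelian variety is étale for `n` invertible: reduction to `Lie([n]) = n`

`Literature.AlgebraicGeometry.Motives.AbelianVarietyTorsion` reduces the named fact
`Literature.AlgebraicGeometry.Motives.AbelianVariety.natCard_torsionPoints_of_isAlgClosed` (`#A[n](L) = n^{2g}` over an algebraically
closed field `L`, `n` invertible in the ground field `K`) to two named facts: `kerRank_zsmul_id`
(`deg [n]_A = n^{2g}`, Görtz–Wedhorn, *Algebraic Geometry II*, Prop. 27.186 — theorem of the cube)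
and `etale_zsmul_id` (`[n]_A` is étale for `n ∈ K^×`, *loc. cit.* Prop. 27.187). This file **proves**
the second one from the much more elementary named fact

* `cotangentMap_zsmul_id A` : `[n]_A^*` acts on the cotangent space `𝔪_e/𝔪_e²` of `A` at the
  origin as multiplication by `n` — the statement "`Lie([n]) = n`" of Görtz–Wedhorn II, proof of
  Prop. 27.187, p. 888 with Rem. 27.18 (3), p. 806, written on the cotangent space `𝔪_e/𝔪_e²`
  (whose `K`-dual is `Lie(A) = T_e A`, Def. 27.17), i.e. `[n]^* a - n a ∈ 𝔪_e²` for `a ∈ 𝔪_e`;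

namely `etale_zsmul_id_of_cotangentMap : cotangentMap_zsmul_id A → etale_zsmul_id A`, together with
`isIsogeny_zsmul_id_of_cotangentMap` (`[n]_A` is an isogeny for `n ∈ K^×`) and the corresponding
sharpening `natCard_torsionPoints_of_isAlgClosed_of_cotangentMap` of the assembly (the target now
follows from `kerRank_zsmul_id` and `cotangentMap_zsmul_id`).

## The proof

Görtz–Wedhorn prove Prop. 27.187 by the infinitesimal criterion Thm. 18.74 (a morphism of smooth
schemes inducing isomorphisms on tangent spaces is étale) and homogeneity over an algebraic closure;
Mathlib has neither tangent spaces of schemes nor smoothness of group schemes. We give instead the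
following argument, which uses only the local ring `𝒪 = 𝒪_{A,e}` at the origin and the group structure.
Let `n ∈ K^×` and `φ = [n]^* : 𝒪 → 𝒪` (a local `K`-algebra endomorphism; `𝒪 = K ⊕ 𝔪` since `e` is
rational). From `φ ≡ n` on `𝔪/𝔪²`:

1. `φ(𝔪)𝒪 = 𝔪` (Nakayama), hence `φ` is formally unramified and `[n]` is quasi-finite at `e`, i.e.
   `e` is isolated in `A[n] = Ker [n]` (Mathlib `quasiFiniteAt_iff_isOpen_singleton_asFiber`);
2. `φ` is injective: `φ` induces surjective, hence injective, endomorphisms of the noetherian modules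
   `𝔪ᵏ/𝔪ᵏ⁺¹` (Vasconcelos/Orzech), and `⋂ 𝔪ᵏ = 0` (Krull); so `[n]` is dominant
   (`Spec 𝒪_{A,e} → A` is dominant), and being proper it is **surjective**;
3. the local ring of `A[n]` at `e` is a field: it is a quotient of `𝒪` in which `φ(𝔪) = 0`
   (as `[n]` is constant on `A[n]`), so its maximal ideal `𝔫` satisfies `𝔫 ⊆ 𝔫²`, `𝔫 = 0`; with 1.,
   the unit `Spec K → A[n]` is an **open immersion**;
4. under the shear isomorphism `A ×_{[n], A, [n]} A ≅ A ×_K A[n]`, `(a, b) ↦ (b, b⁻¹a)`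
   (`AVIsogenyFlat.transIso`), the diagonal of `[n]` is the base change `a ↦ (a, e)` of the unit of
   `A[n]`, hence an open immersion: `[n]` is **unramified** (Mathlib: a morphism whose diagonal is an
   open immersion is formally unramified), so locally quasi-finite, so **finite** (proper; Zariski's
   main theorem, Mathlib `IsFinite.of_isProper_of_locallyQuasiFinite`);
5. a finite surjective homomorphism is an isogeny, hence **flat** (`AVIsogenyFlat`,
   `IsIsogeny.flat`), and flat + unramified + locally of finite presentation is **étale**.

## Main statements

* `Literature.AlgebraicGeometry.Motives.LocalKAlgebra.injective`: a local `K`-algebra endomorphism `φ` of a noetherian local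
  `K`-algebra with residue field `K` and `φ(𝔪)𝒪 = 𝔪` is injective.
* `Literature.AlgebraicGeometry.Motives.maximalIdeal_stalk_pullback_eq_bot`: local rings of fibres at cotangent-surjective points are
  fields.
* `Literature.AlgebraicGeometry.Motives.surjective_of_stalkMap_injective`: a universally closed morphism to an irreducible scheme with
  an injective stalk map is surjective.
* `Literature.AlgebraicGeometry.Motives.AbelianVariety.cotangentMap_zsmul_id`: the named fact `Lie([n]_A) = n`.
* `Literature.AlgebraicGeometry.Motives.AbelianVariety.surjective_zsmul_id`, `formallyUnramified_zsmul_id`,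
  `isIsogeny_zsmul_id_of_cotangentMap`, `etale_zsmul_id_of_cotangentMap`,
  `natCard_torsionPoints_of_isAlgClosed_of_cotangentMap`.

## References

* U. Görtz, T. Wedhorn, *Algebraic Geometry II* (2023): Def. 27.17 and Rem. 27.18 (3), (4)
  (pp. 805–806, `Lie(G)`, `T_e(m)` is addition), Prop. 27.186–27.187 (pp. 887–888), proof of
  Prop. 27.187 (p. 888: "`Lie([n])` is simply the multiplication by `n`"). [GortzWedhorn2023]
* D. Mumford, *Abelian Varieties* (1970), §6, Application 3, Proposition p. 64 (not held).
  [MumfordAV1970]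
-/

universe u

open CategoryTheory CategoryTheory.Limits AlgebraicGeometry

noncomputable section

namespace Literature.AlgebraicGeometry.Motives

/-! ### Local algebra: endomorphisms of noetherian local `K`-algebras with residue field `K` -/

section LocAlgSection
open IsLocalRing

namespace LocalKAlgebra

variable {K O : Type*} [Field K] [CommRing O] [IsLocalRing O] [Algebra K O]

/-- Nakayama: if `φ(𝔪) ⊆ 𝔪` and `𝔪 ⊆ φ(𝔪)O + 𝔪²` (the cotangent map of `φ` is surjective) then
`φ(𝔪)O = 𝔪` (Mathlib `Submodule.le_of_le_smul_of_le_jacobson_bot`). [folklore] -/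
theorem map_maximalIdeal_eq [IsNoetherianRing O] (φ : O →+* O)
    (hφ : ∀ x ∈ maximalIdeal O, φ x ∈ maximalIdeal O)
    (hcot : maximalIdeal O ≤ (maximalIdeal O).map φ ⊔ (maximalIdeal O) ^ 2) :
    (maximalIdeal O).map φ = maximalIdeal O := by
  apply le_antisymm
  · exact Ideal.map_le_iff_le_comap.mpr hφ
  · refine Submodule.le_of_le_smul_of_le_jacobson_bot (I := maximalIdeal O)
      (IsNoetherian.noetherian _) (IsLocalRing.maximalIdeal_le_jacobson _) ?_
    rwa [smul_eq_mul, ← pow_two]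

variable (φ : O →ₐ[K] O)
  (hφ : ∀ x ∈ maximalIdeal O, φ x ∈ maximalIdeal O)
  (hres : ∀ a : O, ∃ c : K, a - algebraMap K O c ∈ maximalIdeal O)

include hφ in
/-- `φ(𝔪ᵏ) ⊆ 𝔪ᵏ`. [folklore] -/
theorem map_pow_mem {k : ℕ} {x : O} (hx : x ∈ maximalIdeal O ^ k) : φ x ∈ maximalIdeal O ^ k := by
  have : (maximalIdeal O ^ k).map φ ≤ maximalIdeal O ^ k := by
    rw [Ideal.map_pow]
    exact Ideal.pow_right_mono (Ideal.map_le_iff_le_comap.mpr hφ) k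
  exact this (Ideal.mem_map_of_mem _ hx)

include hφ hres in
/-- A `K`-algebra endomorphism is the identity modulo `𝔪` when the residue field is `K`. [folklore] -/
theorem map_sub_self_mem (o : O) : φ o - o ∈ maximalIdeal O := by
  obtain ⟨c, hc⟩ := hres o
  have h1 : φ (o - algebraMap K O c) ∈ maximalIdeal O := hφ _ hc
  rw [map_sub, AlgHom.commutes] at h1
  have h2 := Ideal.sub_mem _ h1 hc
  rwa [sub_sub_sub_cancel_right] at h2

include hres in
/-- Graded surjectivity: if `φ(𝔪)O = 𝔪` then every `v ∈ 𝔪ᵏ` is `φ(b) mod 𝔪ᵏ⁺¹` for some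
`b ∈ 𝔪ᵏ` (since `𝔪ᵏ = φ(𝔪ᵏ)O = φ(𝔪ᵏ)(K + 𝔪)`). [folklore] -/
theorem exists_sub_mem_pow_succ (hm : (maximalIdeal O).map φ = maximalIdeal O) (k : ℕ)
    {v : O} (hv : v ∈ maximalIdeal O ^ k) :
    ∃ b ∈ maximalIdeal O ^ k, v - φ b ∈ maximalIdeal O ^ (k + 1) := by
  have hk : (maximalIdeal O ^ k).map φ = maximalIdeal O ^ k := by rw [Ideal.map_pow, hm]
  rw [← hk, Ideal.map, Ideal.span] at hv
  induction hv using Submodule.span_induction with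
  | mem x h =>
    obtain ⟨b, hb, rfl⟩ := h
    exact ⟨b, hb, by simp⟩
  | zero => exact ⟨0, Submodule.zero_mem _, by simp⟩
  | add x y hx hy ihx ihy =>
    obtain ⟨b₁, hb₁, h₁⟩ := ihx
    obtain ⟨b₂, hb₂, h₂⟩ := ihy
    refine ⟨b₁ + b₂, add_mem hb₁ hb₂, ?_⟩
    have : x + y - φ (b₁ + b₂) = (x - φ b₁) + (y - φ b₂) := by rw [map_add]; ring
    rw [this]
    exact add_mem h₁ h₂
  | smul o x hx ihx =>
    obtain ⟨b, hb, h⟩ := ihx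
    obtain ⟨c, hc⟩ := hres o
    have hx' : x ∈ maximalIdeal O ^ k := by
      rw [← hk, Ideal.map, Ideal.span]; exact hx
    refine ⟨algebraMap K O c * b, Ideal.mul_mem_left _ _ hb, ?_⟩
    have : o • x - φ (algebraMap K O c * b) =
        algebraMap K O c * (x - φ b) + (o - algebraMap K O c) * x := by
      rw [map_mul, AlgHom.commutes, smul_eq_mul]; ring
    rw [this]
    refine add_mem (Ideal.mul_mem_left _ _ h) ?_
    rw [pow_succ']
    exact Ideal.mul_mem_mul hc hx'

/-- The submodule `𝔪ᵏ⁺¹ ∩ 𝔪ᵏ` of `𝔪ᵏ`, so that `𝔪ᵏ/𝔪ᵏ⁺¹` is the quotient of the submodule `𝔪ᵏ`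
by it. [folklore] -/
abbrev grSub (O : Type*) [CommRing O] [IsLocalRing O] (k : ℕ) :
    Submodule O ↥(maximalIdeal O ^ k) :=
  Submodule.comap (maximalIdeal O ^ k).subtype (maximalIdeal O ^ (k + 1))

include hφ hres in
/-- The endomorphism `gr^k φ` of `𝔪ᵏ/𝔪ᵏ⁺¹` induced by `φ`; it is `O`-linear because
`φ ≡ id mod 𝔪`. [folklore] -/
theorem exists_grMap (k : ℕ) :
    ∃ g : (↥(maximalIdeal O ^ k) ⧸ grSub O k) →ₗ[O] (↥(maximalIdeal O ^ k) ⧸ grSub O k),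
      ∀ a : ↥(maximalIdeal O ^ k),
        g (Submodule.Quotient.mk a) = Submodule.Quotient.mk ⟨φ a, map_pow_mem φ hφ a.2⟩ := by
  let f₀ : ↥(maximalIdeal O ^ k) →ₗ[O] (↥(maximalIdeal O ^ k) ⧸ grSub O k) :=
    { toFun := fun a => Submodule.Quotient.mk ⟨φ a, map_pow_mem φ hφ a.2⟩
      map_add' := fun a b => by
        rw [← Submodule.Quotient.mk_add]
        congr 1
        ext
        simp
      map_smul' := fun o a => by
        rw [RingHom.id_apply, ← Submodule.Quotient.mk_smul, Submodule.Quotient.eq]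
        change ((⟨φ (o • a), _⟩ : ↥(maximalIdeal O ^ k)) - o • ⟨φ a, _⟩ :
            ↥(maximalIdeal O ^ k)).1 ∈ maximalIdeal O ^ (k + 1)
        simp only [Submodule.coe_smul, smul_eq_mul, map_mul, AddSubgroupClass.coe_sub]
        have : φ o * φ a - o * φ a = (φ o - o) * φ a := by ring
        rw [this, pow_succ']
        exact Ideal.mul_mem_mul (map_sub_self_mem φ hφ hres o) (map_pow_mem φ hφ a.2) }
  refine ⟨(grSub O k).liftQ f₀ ?_, fun a => rfl⟩
  intro a ha
  rw [LinearMap.mem_ker]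
  change Submodule.Quotient.mk _ = (0 : ↥(maximalIdeal O ^ k) ⧸ grSub O k)
  rw [Submodule.Quotient.mk_eq_zero]
  exact map_pow_mem φ hφ (Submodule.mem_comap.mp ha)

include hφ hres in
/-- Graded injectivity: if `φ(𝔪)O = 𝔪`, `a ∈ 𝔪ᵏ` and `φ a ∈ 𝔪ᵏ⁺¹` then `a ∈ 𝔪ᵏ⁺¹`: the
surjective endomorphism `gr^k φ` of the noetherian module `𝔪ᵏ/𝔪ᵏ⁺¹` is injective (Vasconcelos;
Mathlib `IsNoetherian.injective_of_surjective_endomorphism`). [folklore] -/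
theorem mem_pow_succ_of_map_mem [IsNoetherianRing O] (hm : (maximalIdeal O).map φ = maximalIdeal O)
    (k : ℕ) {a : O} (ha : a ∈ maximalIdeal O ^ k) (hφa : φ a ∈ maximalIdeal O ^ (k + 1)) :
    a ∈ maximalIdeal O ^ (k + 1) := by
  obtain ⟨g, hg⟩ := exists_grMap φ hφ hres k
  have hsurj : Function.Surjective g := by
    intro q
    obtain ⟨v, rfl⟩ := Submodule.Quotient.mk_surjective _ q
    obtain ⟨b, hb, h⟩ := exists_sub_mem_pow_succ φ hres hm k v.2
    refine ⟨Submodule.Quotient.mk ⟨b, hb⟩, ?_⟩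
    rw [hg, Submodule.Quotient.eq]
    change ((⟨φ b, _⟩ : ↥(maximalIdeal O ^ k)) - v : ↥(maximalIdeal O ^ k)).1 ∈
      maximalIdeal O ^ (k + 1)
    rw [AddSubgroupClass.coe_sub, ← neg_sub]
    exact neg_mem h
  haveI : IsNoetherian O ↥(maximalIdeal O ^ k) := isNoetherian_submodule' _
  have hinj : Function.Injective g := IsNoetherian.injective_of_surjective_endomorphism g hsurj
  have h0 : g (Submodule.Quotient.mk ⟨a, ha⟩) = 0 := by
    rw [hg, Submodule.Quotient.mk_eq_zero]
    exact hφa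
  have : (Submodule.Quotient.mk ⟨a, ha⟩ : ↥(maximalIdeal O ^ k) ⧸ grSub O k) = 0 :=
    hinj (by rw [h0, map_zero])
  rw [Submodule.Quotient.mk_eq_zero] at this
  exact this

include hφ hres in
/-- **Injectivity.** A local `K`-algebra endomorphism `φ` of a noetherian local `K`-algebra `O`
with residue field `K` such that `φ(𝔪)O = 𝔪` is injective: by graded injectivity a nonzero
`a ∈ 𝔪ᵏ ∖ 𝔪ᵏ⁺¹` has `φ a ∉ 𝔪ᵏ⁺¹`, and `⋂ₖ 𝔪ᵏ = 0` (Krull's intersection theorem, Mathlib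
`Ideal.iInf_pow_eq_bot_of_isLocalRing`). [folklore] -/
theorem injective [IsNoetherianRing O] (hm : (maximalIdeal O).map φ = maximalIdeal O) :
    Function.Injective φ := by
  rw [injective_iff_map_eq_zero]
  intro a ha
  by_contra hne
  have hkrull : ⨅ i : ℕ, maximalIdeal O ^ i = ⊥ :=
    Ideal.iInf_pow_eq_bot_of_isLocalRing _ Ideal.IsPrime.ne_top'
  have hex : ∃ k, a ∉ maximalIdeal O ^ k := by
    by_contra h
    push Not at h
    have : a ∈ ⨅ i : ℕ, maximalIdeal O ^ i := Ideal.mem_iInf.mpr h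
    rw [hkrull] at this
    exact hne this
  classical
  let k := Nat.find hex
  have hk : a ∉ maximalIdeal O ^ k := Nat.find_spec hex
  have hk0 : k ≠ 0 := by
    intro h0
    apply hk
    rw [h0, pow_zero, Ideal.one_eq_top]
    exact Submodule.mem_top
  obtain ⟨j, hj⟩ := Nat.exists_eq_succ_of_ne_zero hk0
  have hj' : a ∈ maximalIdeal O ^ j := by
    have := Nat.find_min hex (m := j) (by omega)
    simpa using this
  apply hk
  rw [hj]
  exact mem_pow_succ_of_map_mem φ hφ hres hm j hj' (by rw [ha]; exact Submodule.zero_mem _)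

end LocalKAlgebra

end LocAlgSection

/-! ### A lemma on local homomorphisms -/

section LocalRingLemmas

open IsLocalRing

/-- A local homomorphism into a local ring whose maximal ideal is zero (a field) kills the
maximal ideal (one-line wrapper of Mathlib `IsLocalRing.map_maximalIdeal_le`). [folklore] -/
theorem map_maximalIdeal_eq_bot {R S : Type*} [CommRing R] [CommRing S] [IsLocalRing R]
    [IsLocalRing S] (χ : R →+* S) [IsLocalHom χ] (hS : maximalIdeal S = ⊥) :
    (maximalIdeal R).map χ = ⊥ :=
  le_bot_iff.mp (hS ▸ IsLocalRing.map_maximalIdeal_le χ)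

end LocalRingLemmas

/-! ### The point and the stalk of `Spec K` -/

section SpecField

variable (K : Type u) [Field K]

/-- The point of `Spec K` (as a term of the underlying type of the scheme `Spec K`). [folklore] -/
def specPt : ↥(Spec (CommRingCat.of K)) := IsLocalRing.closedPoint K

/-- `Spec K` has exactly one point. [folklore] -/
theorem eq_specPt (x : ↥(Spec (CommRingCat.of K))) : x = specPt K :=
  Subsingleton.elim (α := PrimeSpectrum K) _ _

/-- Every element of the stalk of `Spec K` at its point is the germ of a global section. [folklore] -/
theorem exists_germ_top_eq (t : (Spec (.of K)).presheaf.stalk (specPt K)) :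
    ∃ s : Γ(Spec (.of K), ⊤), (Spec (.of K)).presheaf.germ ⊤ (specPt K) trivial s = t := by
  obtain ⟨U, hU, s, rfl⟩ := (Spec (.of K)).presheaf.exists_germ_eq t
  have hU' : U = ⊤ := by
    ext x
    exact ⟨fun _ => trivial, fun _ => (eq_specPt K x) ▸ hU⟩
  subst hU'
  exact ⟨s, rfl⟩

/-- The stalk of `Spec K` at its point is a field: its maximal ideal is zero. [folklore] -/
theorem maximalIdeal_stalk_specPt :
    IsLocalRing.maximalIdeal ((Spec (.of K)).presheaf.stalk (specPt K)) = ⊥ := by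
  rw [eq_bot_iff]
  intro t ht
  obtain ⟨s, rfl⟩ := exists_germ_top_eq K t
  by_contra hne
  have hs : s ≠ 0 := by rintro rfl; exact hne (by simp)
  have hsu : IsUnit ((Scheme.ΓSpecIso (.of K)).hom s) :=
    isUnit_iff_ne_zero.mpr fun h0 => hs (by
      have := congrArg (Scheme.ΓSpecIso (.of K)).inv h0
      rwa [← CommRingCat.comp_apply, Iso.hom_inv_id, CommRingCat.id_apply, map_zero] at this)
  have hsu' : IsUnit s := by
    have := hsu.map (Scheme.ΓSpecIso (.of K)).inv.hom
    rwa [← CommRingCat.comp_apply, Iso.hom_inv_id, CommRingCat.id_apply] at this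
  exact (IsLocalRing.mem_maximalIdeal _).mp ht
    (hsu'.map ((Spec (.of K)).presheaf.germ ⊤ (specPt K) trivial).hom)

end SpecField

/-! ### Local rings of fibres at cotangent-surjective points -/

section FibreStalk

open IsLocalRing

/-- **The local ring of a fibre product at a point over a "cotangent-surjective" point is a
field.** Let `k` be a point of `X ×_Y Z` with images `x ∈ X` and `z ∈ Z`; assume that the stalk
of `Z` at `z` is a field, that `X ×_Y Z → X` is surjective on stalks (e.g. `Z → Y` is a closed
immersion), that the local ring at `k` is noetherian, and that the cotangent map of `f` at `x` is
surjective: `𝔪_x ⊆ f^*(𝔪_{f x}) 𝒪_x + 𝔪_x²`. Then the maximal ideal `𝔫` of `𝒪_{X ×_Y Z, k}` is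
zero: `𝔫` is the image of `𝔪_x`, the image of `f^*(𝔪_{f x})` vanishes (it factors through the stalk
of `Z`), so `𝔫 ⊆ 𝔫²` and Nakayama applies (informally: the fibre `f⁻¹(f x)` is reduced — indeed
étale — at a point where `f` is unramified). [folklore] -/
theorem maximalIdeal_stalk_pullback_eq_bot {X Y Z : Scheme.{u}} (f : X ⟶ Y) (g : Z ⟶ Y)
    [SurjectiveOnStalks (pullback.fst f g)] (k : ↥(pullback f g))
    [IsNoetherianRing ((pullback f g).presheaf.stalk k)]
    (hZ : maximalIdeal (Z.presheaf.stalk ((pullback.snd f g).base k)) = ⊥)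
    (hcot : maximalIdeal (X.presheaf.stalk ((pullback.fst f g).base k)) ≤
      (maximalIdeal (Y.presheaf.stalk (f.base ((pullback.fst f g).base k)))).map
          (f.stalkMap ((pullback.fst f g).base k)).hom ⊔
        maximalIdeal (X.presheaf.stalk ((pullback.fst f g).base k)) ^ 2) :
    maximalIdeal ((pullback f g).presheaf.stalk k) = ⊥ := by
  set x := (pullback.fst f g).base k with hx
  let ψ := (pullback.fst f g).stalkMap k
  have hψ : Function.Surjective ψ := (pullback.fst f g).stalkMap_surjective k
  -- `𝔪_k = ψ(𝔪_x)`
  have h1 : maximalIdeal ((pullback f g).presheaf.stalk k) = (maximalIdeal _).map ψ.hom :=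
    (IsLocalRing.map_maximalIdeal_of_surjective ψ.hom hψ).symm
  -- `ψ ∘ f^*` kills `𝔪_{f x}`: it factors through the stalk of `Z`, a field
  -- the stalk map of `X ×_Y Z → Z → Y` at `k` kills `𝔪`, since the stalk of `Z` is a field
  have key : ∀ h : pullback f g ⟶ Y, h = pullback.snd f g ≫ g →
      ∀ a ∈ maximalIdeal (Y.presheaf.stalk (h.base k)), h.stalkMap k a = 0 := by
    rintro h rfl a ha
    have e1 : (pullback.snd f g ≫ g).stalkMap k a =
        (pullback.snd f g).stalkMap k (g.stalkMap ((pullback.snd f g).base k) a) := by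
      rw [Scheme.Hom.stalkMap_comp]; rfl
    have hga : g.stalkMap ((pullback.snd f g).base k) a ∈
        (maximalIdeal _).map (g.stalkMap ((pullback.snd f g).base k)).hom :=
      Ideal.mem_map_of_mem _ ha
    rw [map_maximalIdeal_eq_bot _ hZ, Ideal.mem_bot] at hga
    rw [e1, hga, map_zero]
  have h2 : ((maximalIdeal (Y.presheaf.stalk (f.base x))).map (f.stalkMap x).hom).map ψ.hom =
      ⊥ := by
    rw [eq_bot_iff, Ideal.map_map, Ideal.map_le_iff_le_comap]
    intro a ha
    rw [Ideal.mem_comap, Ideal.mem_bot, RingHom.comp_apply]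
    have e2 : ψ.hom ((f.stalkMap x).hom a) = (pullback.fst f g ≫ f).stalkMap k a := by
      rw [Scheme.Hom.stalkMap_comp]; rfl
    rw [e2, Scheme.Hom.stalkMap_congr_hom _ _ pullback.condition k, CommRingCat.comp_apply]
    refine key _ rfl _ ((mem_maximalIdeal _).mpr fun hu => (mem_maximalIdeal _).mp ha ?_)
    have := hu.map (Y.presheaf.stalkCongr (.of_eq
      (show (pullback.fst f g ≫ f).base k = (pullback.snd f g ≫ g).base k by
        rw [pullback.condition]))).inv.hom
    rwa [Iso.hom_inv_id_apply] at this
  -- hence `𝔪_k ⊆ 𝔪_k²`, and Nakayama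
  have h3 : maximalIdeal ((pullback f g).presheaf.stalk k) ≤
      maximalIdeal ((pullback f g).presheaf.stalk k) ^ 2 := by
    conv_lhs => rw [h1]
    refine (Ideal.map_mono hcot).trans ?_
    rw [Ideal.map_sup, h2, bot_sup_eq, Ideal.map_pow, ← h1]
  refine Submodule.eq_bot_of_le_smul_of_le_jacobson_bot _ _ (IsNoetherian.noetherian _) ?_
    (maximalIdeal_le_jacobson _)
  rwa [smul_eq_mul, ← pow_two]

end FibreStalk

/-! ### Dominance from an injective stalk map -/

/-- If `Y` is irreducible and some stalk map `𝒪_{Y, f x} → 𝒪_{X, x}` of `f : X → Y` is injective,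
then `f` is dominant: `Spec 𝒪_{X,x} → X → Y` equals `Spec 𝒪_{X,x} → Spec 𝒪_{Y,f x} → Y`, the first
map is dominant because the ring map is injective (Mathlib
`PrimeSpectrum.denseRange_comap_iff_ker_le_nilRadical`) and the second because its image, the set
of generizations of `f x`, contains the generic point. [folklore] -/
theorem isDominant_of_stalkMap_injective {X Y : Scheme.{u}} (f : X ⟶ Y) [IrreducibleSpace Y]
    (x : X) (hinj : Function.Injective (f.stalkMap x)) : IsDominant f := by
  have h1 : IsDominant (Y.fromSpecStalk (f.base x)) := by
    rw [isDominant_iff]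
    have hη : genericPoint Y ∈ Set.range (Y.fromSpecStalk (f.base x)) := by
      rw [Scheme.range_fromSpecStalk]
      exact genericPoint_specializes (f.base x)
    rw [denseRange_iff_closure_range]
    apply Set.eq_univ_of_univ_subset
    have hg : closure ({genericPoint Y} : Set Y) = Set.univ := (genericPoint_spec Y).def
    rw [← hg]
    exact closure_mono (Set.singleton_subset_iff.mpr hη)
  have h2 : IsDominant (Spec.map (f.stalkMap x)) := by
    rw [isDominant_iff]
    have : DenseRange (PrimeSpectrum.comap (f.stalkMap x).hom) := by
      rw [PrimeSpectrum.denseRange_comap_iff_ker_le_nilRadical]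
      intro a ha
      rw [RingHom.mem_ker] at ha
      have : a = 0 := hinj (by rw [ha, map_zero])
      rw [this]; exact Ideal.zero_mem _
    exact this
  have : IsDominant (X.fromSpecStalk x ≫ f) := by
    rw [← Scheme.SpecMap_stalkMap_fromSpecStalk]; infer_instance
  exact IsDominant.of_comp (X.fromSpecStalk x) f

/-- A universally closed morphism to an irreducible scheme with an injective stalk map is
surjective (dominant with closed image). [folklore] -/
theorem surjective_of_stalkMap_injective {X Y : Scheme.{u}} (f : X ⟶ Y) [IrreducibleSpace Y]
    [UniversallyClosed f] (x : X) (hinj : Function.Injective (f.stalkMap x)) : Surjective f :=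
  haveI := isDominant_of_stalkMap_injective f x hinj
  surjective_of_isDominant_of_isClosed_range f f.isClosedMap.isClosed_range

/-! ### The local ring of an abelian variety at the origin -/

namespace AbelianVariety

open scoped MonObj

variable {K : Type u} [Field K] (A : AbelianVariety K)

/-- An abelian variety is locally noetherian (it is of finite type over a field; Mathlib
`LocallyOfFiniteType.isLocallyNoetherian`). [folklore] -/
instance : IsLocallyNoetherian A.X.left := LocallyOfFiniteType.isLocallyNoetherian A.X.hom

/-- The origin `e ∈ A` as a point of the underlying topological space: the image of the unit
section `Spec K → A` (Görtz–Wedhorn II, (27.1), p. 800). [folklore] -/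
abbrev origin : A.X.left := (unitPt A).base (specPt K)

variable {A} {B : AbelianVariety K}

/-- A homomorphism preserves the unit section: `f ∘ e_A = e_B` (Mathlib `IsMonHom.one_hom`). [folklore] -/
@[reassoc]
theorem unitPt_comp_toSchemeHom (f : A ⟶ B) : unitPt A ≫ Hom.toSchemeHom f = unitPt B := by
  have := IsMonHom.one_hom (f := f.hom.hom.hom)
  exact congrArg CommaMorphism.left this

/-- A homomorphism maps the origin to the origin. [folklore] -/
theorem toSchemeHom_origin (f : A ⟶ B) : (Hom.toSchemeHom f).base (origin A) = origin B := by
  simp only [origin, ← Scheme.Hom.comp_apply, unitPt_comp_toSchemeHom]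

variable (A)

/-- The local ring `𝒪_{A,e}` at the origin. [folklore] -/
abbrev stalkOrigin : CommRingCat.{u} := A.X.left.presheaf.stalk (origin A)

/-- The endomorphism `[n]^*` of the local ring `𝒪_{A, e}` at the origin induced by
`[n]_A = n • 𝟙 A`: the stalk map of `[n]_A` at `e`, transported along `[n] e = e`
(Görtz–Wedhorn II, (17.6.9) and Rem. 27.18 (1): functoriality of `T_e`). [folklore] -/
def stalkMapZsmulId (n : ℤ) : stalkOrigin A ⟶ stalkOrigin A :=
  (A.X.left.presheaf.stalkCongr (.of_eq (toSchemeHom_origin (n • 𝟙 A)))).inv ≫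
    (Hom.toSchemeHom (n • 𝟙 A)).stalkMap (origin A)

/-- `[n]^*` is a local homomorphism. [folklore] -/
instance (n : ℤ) : IsLocalHom (stalkMapZsmulId A n).hom := by
  unfold stalkMapZsmulId
  rw [CommRingCat.hom_comp]
  infer_instance

/-- The `K`-algebra structure map of the local ring at the origin:
`K = Γ(Spec K, 𝒪) → Γ(A, 𝒪_A) → 𝒪_{A, e}` (used through `letI := (stalkOriginAlgebraMap A).toAlgebra`,
never as a global instance). [folklore] -/
def stalkOriginAlgebraMap : K →+* stalkOrigin A :=
  (A.X.left.presheaf.germ ⊤ (origin A) trivial).hom.comp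
    (A.X.hom.appTop.hom.comp (Scheme.ΓSpecIso (.of K)).inv.hom)

/-- Unfolding of `stalkOriginAlgebraMap`. [folklore] -/
theorem stalkOriginAlgebraMap_apply (c : K) :
    stalkOriginAlgebraMap A c =
      A.X.left.presheaf.germ ⊤ (origin A) trivial (A.X.hom.appTop ((Scheme.ΓSpecIso (.of K)).inv c)) :=
  rfl

/-- `[n]^*` is `K`-linear: it fixes the image of `K` in `𝒪_{A, e}` (because `[n]_A` is a
`K`-morphism). [folklore] -/
theorem stalkMapZsmulId_algebraMap (n : ℤ) (c : K) :
    stalkMapZsmulId A n (stalkOriginAlgebraMap A c) = stalkOriginAlgebraMap A c := by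
  rw [stalkOriginAlgebraMap_apply, stalkMapZsmulId, CommRingCat.comp_apply]
  have h1 : (A.X.left.presheaf.stalkCongr
      (.of_eq (toSchemeHom_origin (n • 𝟙 A)))).inv
        (A.X.left.presheaf.germ ⊤ (origin A) trivial
          (A.X.hom.appTop ((Scheme.ΓSpecIso (.of K)).inv c))) =
      A.X.left.presheaf.germ ⊤ ((Hom.toSchemeHom (n • 𝟙 A)).base (origin A)) trivial
        (A.X.hom.appTop ((Scheme.ΓSpecIso (.of K)).inv c)) := by
    rw [TopCat.Presheaf.stalkCongr_inv]
    exact TopCat.Presheaf.germ_stalkSpecializes_apply _ _ _ _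
  rw [h1, Scheme.Hom.germ_stalkMap_apply]
  exact congrArg (fun g : A.X.left ⟶ Spec (.of K) =>
    A.X.left.presheaf.germ ⊤ (origin A) trivial (g.appTop ((Scheme.ΓSpecIso (.of K)).inv c)))
    (toSchemeHom_comp_hom (n • 𝟙 A))

/-- Evaluation at the origin: `𝒪_{A,e} = K + 𝔪_e`, i.e. every germ is congruent modulo `𝔪_e` to a
constant, because the origin is a `K`-rational point (evaluate along the unit section
`Spec K → A`). [folklore] -/
theorem exists_sub_algebraMap_mem_maximalIdeal (a : stalkOrigin A) :
    ∃ c : K, a - stalkOriginAlgebraMap A c ∈ IsLocalRing.maximalIdeal (stalkOrigin A) := by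
  let χ := (unitPt A).stalkMap (specPt K)
  obtain ⟨s, hs⟩ := exists_germ_top_eq K (χ a)
  refine ⟨(Scheme.ΓSpecIso (.of K)).hom s, ?_⟩
  have hχ : χ (stalkOriginAlgebraMap A ((Scheme.ΓSpecIso (.of K)).hom s)) = χ a := by
    rw [stalkOriginAlgebraMap_apply, ← CommRingCat.comp_apply (Scheme.ΓSpecIso (.of K)).hom,
      Iso.hom_inv_id, CommRingCat.id_apply, ← hs]
    change ((unitPt A).stalkMap (specPt K))
      (A.X.left.presheaf.germ ⊤ ((unitPt A).base (specPt K)) trivial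
        (A.X.hom.appTop s)) = _
    rw [Scheme.Hom.germ_stalkMap_apply]
    exact congrArg (fun g : Spec (.of K) ⟶ Spec (.of K) =>
      (Spec (.of K)).presheaf.germ ⊤ (specPt K) trivial (g.appTop s))
      (unitPt_comp_hom (B := A))
  have hχ' : χ.hom (stalkOriginAlgebraMap A ((Scheme.ΓSpecIso (.of K)).hom s)) = χ.hom a := hχ
  have h0 : χ.hom (a - stalkOriginAlgebraMap A ((Scheme.ΓSpecIso (.of K)).hom s)) = 0 := by
    rw [map_sub, hχ', sub_self]
  rw [IsLocalRing.mem_maximalIdeal]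
  intro hu
  exact not_isUnit_zero (h0 ▸ hu.map χ.hom)

/-- **`Lie([n]_A) = n`.** For an abelian variety `A` over a field `K` and `n ∈ ℤ`, the
endomorphism `[n]_A^*` of the local ring `𝒪_{A,e}` at the origin acts on the cotangent space
`𝔪_e/𝔪_e²` as multiplication by `n`: `[n]^* a - n a ∈ 𝔪_e²` for all `a ∈ 𝔪_e` (Görtz–Wedhorn II,
proof of Prop. 27.187, p. 888: "`Lie([n])` is simply the multiplication by `n`
(Remark 27.18 (3))", where `Lie(A) = T_e(A)` is the `K`-dual of the cotangent space `𝔪_e/𝔪_e²` at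
the rational point `e`, Def. 27.17, p. 805, and `T_e([n])` is the transpose of the map induced by
`[n]^*` on `𝔪_e/𝔪_e²`, (17.6.9); the two formulations are equivalent since `𝔪_e/𝔪_e²` is
finite-dimensional). Printed proof: `T_e(m) : T_e A ⊕ T_e A → T_e A` is addition (Rem. 27.18 (3),
p. 806, from `m ∘ (id, e) = id = m ∘ (e, id)`), hence `T_e([n]) = n` by induction, `[n]` being the
`n`-th power of `id` for the group law. Mumford, *Abelian Varieties*, §4 (iv), p. 42 (not held).
[cite: GortzWedhorn2023, proof of Prop. 27.187 (p. 888) and Rem. 27.18 (3)] -/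
def cotangentMap_zsmul_id : Prop :=
  ∀ (n : ℤ) (a : stalkOrigin A), a ∈ IsLocalRing.maximalIdeal (stalkOrigin A) →
    stalkMapZsmulId A n a - n • a ∈ IsLocalRing.maximalIdeal (stalkOrigin A) ^ 2

variable {A}

/-! ### Consequences of `Lie([n]) = n` at the origin: `[n]` is surjective -/

/-- Homomorphisms of abelian varieties are proper, as morphisms between proper `K`-schemes
(Mathlib `IsProper.of_comp`). [folklore] -/
theorem isProper_toSchemeHom (f : A ⟶ B) : IsProper (Hom.toSchemeHom f) := by
  have hw : Hom.toSchemeHom f ≫ B.X.hom = A.X.hom := Over.w f.hom.hom.hom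
  have : IsProper (Hom.toSchemeHom f ≫ B.X.hom) := by rw [hw]; infer_instance
  exact IsProper.of_comp (Hom.toSchemeHom f) B.X.hom

/-- `[n]^*` maps `𝔪_e` into `𝔪_e` (it is a local homomorphism). [folklore] -/
theorem stalkMapZsmulId_mem (n : ℤ) {x : stalkOrigin A}
    (hx : x ∈ IsLocalRing.maximalIdeal (stalkOrigin A)) :
    stalkMapZsmulId A n x ∈ IsLocalRing.maximalIdeal (stalkOrigin A) :=
  map_nonunit (stalkMapZsmulId A n).hom x hx

/-- From `Lie([n]) = n` with `n` invertible in `K`: `𝔪_e ⊆ [n]^*(𝔪_e) 𝒪 + 𝔪_e²`, i.e. the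
cotangent map of `[n]` at `e` is surjective (Görtz–Wedhorn II, proof of Prop. 27.187: `Lie([n])`
is bijective for `n` invertible). [cite: GortzWedhorn2023, proof of Prop. 27.187 (p. 888)] -/
theorem maximalIdeal_le_of_cotangentMap (h : cotangentMap_zsmul_id A) (n : ℤ) (hn : (n : K) ≠ 0) :
    IsLocalRing.maximalIdeal (stalkOrigin A) ≤
      (IsLocalRing.maximalIdeal (stalkOrigin A)).map (stalkMapZsmulId A n).hom ⊔
        IsLocalRing.maximalIdeal (stalkOrigin A) ^ 2 := by
  intro a ha
  have h1 := h n a ha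
  have hφa : stalkMapZsmulId A n a ∈
      (IsLocalRing.maximalIdeal (stalkOrigin A)).map (stalkMapZsmulId A n).hom :=
    Ideal.mem_map_of_mem _ ha
  have h2 : n • a ∈ (IsLocalRing.maximalIdeal (stalkOrigin A)).map (stalkMapZsmulId A n).hom ⊔
      IsLocalRing.maximalIdeal (stalkOrigin A) ^ 2 := by
    have : n • a = stalkMapZsmulId A n a - (stalkMapZsmulId A n a - n • a) := by ring
    rw [this]
    exact Ideal.sub_mem _ (Ideal.mem_sup_left hφa) (Ideal.mem_sup_right h1)
  have h3 : a = stalkOriginAlgebraMap A ((n : K)⁻¹) * (n • a) := by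
    rw [zsmul_eq_mul, ← mul_assoc, ← map_intCast (stalkOriginAlgebraMap A) n, ← map_mul,
      inv_mul_cancel₀ hn, map_one, one_mul]
  rw [h3]
  exact Ideal.mul_mem_left _ _ h2

/-- `[n]^*(𝔪_e) 𝒪_{A,e} = 𝔪_e` for `n` invertible in `K` (Nakayama). [folklore] -/
theorem map_maximalIdeal_stalkMapZsmulId (h : cotangentMap_zsmul_id A) (n : ℤ) (hn : (n : K) ≠ 0) :
    (IsLocalRing.maximalIdeal (stalkOrigin A)).map (stalkMapZsmulId A n).hom =
      IsLocalRing.maximalIdeal (stalkOrigin A) :=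
  LocalKAlgebra.map_maximalIdeal_eq _ (fun _ hx => stalkMapZsmulId_mem n hx)
    (maximalIdeal_le_of_cotangentMap h n hn)

/-- **`[n]^*` is injective on `𝒪_{A,e}`** for `n` invertible in `K` (`LocalKAlgebra.injective`:
graded pieces and Krull's intersection theorem). [folklore] -/
theorem stalkMapZsmulId_injective (h : cotangentMap_zsmul_id A) (n : ℤ) (hn : (n : K) ≠ 0) :
    Function.Injective (stalkMapZsmulId A n) := by
  letI : Algebra K (stalkOrigin A) := (stalkOriginAlgebraMap A).toAlgebra
  let φ : stalkOrigin A →ₐ[K] stalkOrigin A :=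
    { (stalkMapZsmulId A n).hom with commutes' := stalkMapZsmulId_algebraMap A n }
  exact LocalKAlgebra.injective φ (fun _ hx => stalkMapZsmulId_mem n hx)
    (exists_sub_algebraMap_mem_maximalIdeal A) (map_maximalIdeal_stalkMapZsmulId h n hn)

/-- The stalk map of `[n]_A` at the origin is injective for `n` invertible in `K`. [folklore] -/
theorem stalkMap_zsmul_id_injective (h : cotangentMap_zsmul_id A) (n : ℤ) (hn : (n : K) ≠ 0) :
    Function.Injective ((Hom.toSchemeHom (n • 𝟙 A)).stalkMap (origin A)) := by
  have he : (Hom.toSchemeHom (n • 𝟙 A)).stalkMap (origin A) =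
      (A.X.left.presheaf.stalkCongr (.of_eq (toSchemeHom_origin (n • 𝟙 A)))).hom ≫
        stalkMapZsmulId A n := by
    rw [stalkMapZsmulId, Iso.hom_inv_id_assoc]
  rw [he]
  intro x y hxy
  rw [CommRingCat.comp_apply, CommRingCat.comp_apply] at hxy
  exact (ConcreteCategory.bijective_of_isIso
    (A.X.left.presheaf.stalkCongr (.of_eq (toSchemeHom_origin (n • 𝟙 A)))).hom).1
      (stalkMapZsmulId_injective h n hn hxy)

/-- **`[n]_A` is surjective for `n` invertible in `K`** (given `Lie([n]) = n`): its stalk map at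
the origin is injective, so `[n]_A` is dominant (`surjective_of_stalkMap_injective`), and it is
proper (Görtz–Wedhorn II, Prop. 27.187 with Def. 27.176: `[n]` is an isogeny, in particular
surjective; the printed argument uses étaleness instead). [cite: GortzWedhorn2023, Prop. 27.187] -/
theorem surjective_zsmul_id (h : cotangentMap_zsmul_id A) (n : ℤ) (hn : (n : K) ≠ 0) :
    Surjective (Hom.toSchemeHom (n • 𝟙 A)) :=
  haveI := isProper_toSchemeHom (n • 𝟙 A)
  surjective_of_stalkMap_injective _ (origin A) (stalkMap_zsmul_id_injective h n hn)

/-! ### The kernel `A[n]` at the origin -/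

section Kernel

variable (f : A ⟶ B)

/-- The unit section is a closed immersion: a section of the separated morphism `A → Spec K`
(Mathlib `IsClosedImmersion.of_comp`). [folklore] -/
instance isClosedImmersion_unitPt : IsClosedImmersion (unitPt A) := by
  have : IsClosedImmersion (unitPt A ≫ A.X.hom) := by rw [unitPt_comp_hom]; infer_instance
  exact IsClosedImmersion.of_comp (unitPt A) A.X.hom

/-- A homomorphism of abelian varieties is locally of finite type (a morphism between `K`-schemes
of finite type). [folklore] -/
instance locallyOfFiniteType_toSchemeHom : LocallyOfFiniteType (Hom.toSchemeHom f) := by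
  have hw : Hom.toSchemeHom f ≫ B.X.hom = A.X.hom := Over.w f.hom.hom.hom
  have : LocallyOfFiniteType (Hom.toSchemeHom f ≫ B.X.hom) := by rw [hw]; infer_instance
  exact locallyOfFiniteType_of_comp (Hom.toSchemeHom f) B.X.hom

/-- `Ker f` is locally noetherian (of finite type over `K`). [folklore] -/
instance : IsLocallyNoetherian (Hom.ker f) :=
  LocallyOfFiniteType.isLocallyNoetherian (Hom.kerι f)

/-- The unit `K`-point `Spec K → Ker f = A ×_{f, B, e} Spec K` of the kernel, with components
`(e_A, id)` (Görtz–Wedhorn II, (27.1.1): `Ker f` is a subgroup scheme). [folklore] -/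
def Hom.kerUnit : Spec (.of K) ⟶ Hom.ker f :=
  pullback.lift (unitPt A) (𝟙 _) (by rw [unitPt_comp_toSchemeHom, Category.id_comp])

/-- First component of the unit point of `Ker f`. [folklore] -/
@[reassoc (attr := simp)]
theorem Hom.kerUnit_kerι : Hom.kerUnit f ≫ Hom.kerι f = unitPt A := pullback.lift_fst _ _ _

/-- The unit point of `Ker f` is a section of `Ker f → Spec K`. [folklore] -/
@[reassoc (attr := simp)]
theorem Hom.kerUnit_kerToSpec : Hom.kerUnit f ≫ Hom.kerToSpec f = 𝟙 _ := pullback.lift_snd _ _ _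

/-- The origin of `Ker f` as a point of the underlying topological space. [folklore] -/
abbrev Hom.kerOrigin : ↥(Hom.ker f) := (Hom.kerUnit f).base (specPt K)

/-- `Ker f → A` maps the origin to the origin. [folklore] -/
theorem Hom.kerι_kerOrigin : (Hom.kerι f).base (Hom.kerOrigin f) = origin A := by
  simp only [← Scheme.Hom.comp_apply, Hom.kerUnit_kerι]

/-- `Ker f → Spec K` maps the origin to the point. [folklore] -/
theorem Hom.kerToSpec_kerOrigin : (Hom.kerToSpec f).base (Hom.kerOrigin f) = specPt K :=
  eq_specPt K _

/-- The range of the unit section is the origin. [folklore] -/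
theorem range_unitPt : Set.range (unitPt A) = {origin A} := by
  ext y
  constructor
  · rintro ⟨p, rfl⟩
    rw [eq_specPt K p]
    rfl
  · rintro rfl
    exact ⟨specPt K, rfl⟩

/-- The image of `Ker f → A` is the fibre of `f` over the origin (Mathlib
`Scheme.Pullback.range_fst`). [folklore] -/
theorem Hom.range_kerι : Set.range (Hom.kerι f) = (Hom.toSchemeHom f) ⁻¹' {origin B} := by
  rw [Scheme.Pullback.range_fst, range_unitPt]

variable {f} in
/-- The surjectivity of the cotangent map of `[n]_A` at a point `x` equal to the origin, in the
untransported form `𝔪_x ⊆ [n]^*(𝔪_{[n] x}) 𝒪_x + 𝔪_x²` consumed by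
`maximalIdeal_stalk_pullback_eq_bot`. [folklore] -/
theorem maximalIdeal_le_of_eq_origin (h : cotangentMap_zsmul_id A) (n : ℤ) (hn : (n : K) ≠ 0)
    {x : A.X.left} (hx : x = origin A) :
    IsLocalRing.maximalIdeal (A.X.left.presheaf.stalk x) ≤
      (IsLocalRing.maximalIdeal (A.X.left.presheaf.stalk
          ((Hom.toSchemeHom (n • 𝟙 A)).base x))).map
          ((Hom.toSchemeHom (n • 𝟙 A)).stalkMap x).hom ⊔
        IsLocalRing.maximalIdeal (A.X.left.presheaf.stalk x) ^ 2 := by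
  subst hx
  set F := Hom.toSchemeHom (n • 𝟙 A)
  have h1 := maximalIdeal_le_of_cotangentMap h n hn
  have h2 : (IsLocalRing.maximalIdeal (stalkOrigin A)).map (stalkMapZsmulId A n).hom =
      (IsLocalRing.maximalIdeal (A.X.left.presheaf.stalk (F.base (origin A)))).map
        (F.stalkMap (origin A)).hom := by
    rw [stalkMapZsmulId, CommRingCat.hom_comp, ← Ideal.map_map]
    congr 1
    exact IsLocalRing.map_maximalIdeal_of_surjective _ (ConcreteCategory.bijective_of_isIso
      (A.X.left.presheaf.stalkCongr (.of_eq (toSchemeHom_origin (n • 𝟙 A)))).inv).2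
  rw [h2] at h1
  exact h1

variable {f} in
/-- **The local ring of `A[n]` at the origin is a field** for `n` invertible in `K` (given
`Lie([n]) = n`): `maximalIdeal_stalk_pullback_eq_bot` for `A[n] = A ×_{[n], A, e} Spec K`
(Görtz–Wedhorn II, Prop. 27.187: `X[n]` is étale). [cite: GortzWedhorn2023, Prop. 27.187] -/
theorem maximalIdeal_stalk_kerOrigin_eq_bot (h : cotangentMap_zsmul_id A) (n : ℤ)
    (hn : (n : K) ≠ 0) :
    IsLocalRing.maximalIdeal ((Hom.ker (n • 𝟙 A)).presheaf.stalk (Hom.kerOrigin (n • 𝟙 A))) =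
      ⊥ := by
  refine maximalIdeal_stalk_pullback_eq_bot (Hom.toSchemeHom (n • 𝟙 A)) (unitPt A)
    (Hom.kerOrigin (n • 𝟙 A)) ?_ (maximalIdeal_le_of_eq_origin h n hn (Hom.kerι_kerOrigin _))
  have := Hom.kerToSpec_kerOrigin (n • 𝟙 A)
  dsimp only [Hom.kerToSpec] at this
  rw [this]
  exact maximalIdeal_stalk_specPt K

variable {f} in
/-- The stalk map of the unit point `Spec K → A[n]` is an isomorphism for `n` invertible in `K`:
it is surjective (a section of `A[n] → Spec K`) and its source is a field. [folklore] -/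
theorem isIso_stalkMap_kerUnit (h : cotangentMap_zsmul_id A) (n : ℤ) (hn : (n : K) ≠ 0)
    (p : ↥(Spec (.of K))) : IsIso ((Hom.kerUnit (n • 𝟙 A)).stalkMap p) := by
  obtain rfl : p = specPt K := eq_specPt K p
  set χ := (Hom.kerUnit (n • 𝟙 A)).stalkMap (specPt K)
  have hB := maximalIdeal_stalk_kerOrigin_eq_bot h n hn
  rw [ConcreteCategory.isIso_iff_bijective]
  constructor
  · -- injective: the source is a field
    intro a b hab
    by_contra hne
    have hu : IsUnit (a - b) := by
      by_contra hnu
      have : a - b ∈ IsLocalRing.maximalIdeal _ := (IsLocalRing.mem_maximalIdeal _).mpr hnu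
      rw [hB, Ideal.mem_bot, sub_eq_zero] at this
      exact hne this
    have := hu.map χ.hom
    rw [map_sub, sub_eq_zero.mpr hab] at this
    exact not_isUnit_zero this
  · -- surjective: `kerUnit` is a section of `kerToSpec`
    intro t
    have heq : Hom.kerUnit (n • 𝟙 A) ≫ Hom.kerToSpec (n • 𝟙 A) = 𝟙 _ := Hom.kerUnit_kerToSpec _
    let c := (Spec (.of K)).presheaf.stalkCongr
      (.of_eq (show (Hom.kerUnit (n • 𝟙 A) ≫ Hom.kerToSpec (n • 𝟙 A)).base (specPt K) =
        (𝟙 (Spec (.of K)) : Spec (.of K) ⟶ _).base (specPt K) by rw [heq]))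
    refine ⟨(Hom.kerToSpec (n • 𝟙 A)).stalkMap _ (c.inv t), ?_⟩
    have e1 : χ ((Hom.kerToSpec (n • 𝟙 A)).stalkMap _ (c.inv t)) =
        (Hom.kerUnit (n • 𝟙 A) ≫ Hom.kerToSpec (n • 𝟙 A)).stalkMap (specPt K) (c.inv t) := by
      rw [Scheme.Hom.stalkMap_comp]; rfl
    rw [e1, Scheme.Hom.stalkMap_congr_hom _ _ heq, CommRingCat.comp_apply, Scheme.Hom.stalkMap_id]
    change c.hom (c.inv t) = t
    rw [Iso.inv_hom_id_apply]

variable {f} in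
/-- **`[n]_A` is unramified at the origin** for `n` invertible in `K` (given `Lie([n]) = n`):
the stalk map `[n]^* : 𝒪_{A,[n] e} → 𝒪_{A,e}` is formally unramified, since `[n]^*(𝔪) 𝒪 = 𝔪_e`
and the residue field extension is trivial (Mathlib `Algebra.FormallyUnramified.of_map_maximalIdeal`;
Görtz–Wedhorn II, proof of Prop. 27.187: `[n]` is étale at the origin).
[cite: GortzWedhorn2023, proof of Prop. 27.187 (p. 888)] -/
theorem formallyUnramified_stalkMap_origin (h : cotangentMap_zsmul_id A) (n : ℤ)
    (hn : (n : K) ≠ 0) :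
    ((Hom.toSchemeHom (n • 𝟙 A)).stalkMap (origin A)).hom.FormallyUnramified := by
  set F := Hom.toSchemeHom (n • 𝟙 A)
  set c := A.X.left.presheaf.stalkCongr (.of_eq (toSchemeHom_origin (n • 𝟙 A)))
  let φ₀ := F.stalkMap (origin A)
  algebraize [φ₀.hom]
  have hloc : IsLocalHom (algebraMap (A.X.left.presheaf.stalk (F.base (origin A)))
      (stalkOrigin A)) := inferInstanceAs (IsLocalHom φ₀.hom)
  -- `[n]^*(𝔪) 𝒪 = 𝔪`
  have H : (IsLocalRing.maximalIdeal _).map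
      (algebraMap (A.X.left.presheaf.stalk (F.base (origin A))) (stalkOrigin A)) =
        IsLocalRing.maximalIdeal _ := by
    rw [RingHom.algebraMap_toAlgebra]
    have h2 := map_maximalIdeal_stalkMapZsmulId h n hn
    rw [stalkMapZsmulId, CommRingCat.hom_comp, ← Ideal.map_map] at h2
    rwa [IsLocalRing.map_maximalIdeal_of_surjective _
      (ConcreteCategory.bijective_of_isIso c.inv).2] at h2
  -- the residue field extension is trivial, in particular separable
  have hsurj : Function.Surjective
      (algebraMap (IsLocalRing.ResidueField (A.X.left.presheaf.stalk (F.base (origin A))))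
        (IsLocalRing.ResidueField (stalkOrigin A))) := by
    intro t
    obtain ⟨a, rfl⟩ := IsLocalRing.residue_surjective t
    obtain ⟨k, hk⟩ := exists_sub_algebraMap_mem_maximalIdeal A a
    refine ⟨IsLocalRing.residue _ (c.inv (stalkOriginAlgebraMap A k)), ?_⟩
    rw [IsLocalRing.ResidueField.algebraMap_residue, RingHom.algebraMap_toAlgebra]
    have e1 : φ₀.hom (c.inv (stalkOriginAlgebraMap A k)) = stalkMapZsmulId A n
        (stalkOriginAlgebraMap A k) := by
      rw [stalkMapZsmulId, CommRingCat.comp_apply]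
    rw [e1, stalkMapZsmulId_algebraMap, eq_comm, ← sub_eq_zero, ← map_sub,
      IsLocalRing.residue_eq_zero_iff]
    exact hk
  haveI : Algebra.IsSeparable
      (IsLocalRing.ResidueField (A.X.left.presheaf.stalk (F.base (origin A))))
      (IsLocalRing.ResidueField (stalkOrigin A)) :=
    ⟨fun x => by
      obtain ⟨y, rfl⟩ := hsurj x
      exact isSeparable_algebraMap y⟩
  haveI : Algebra.EssFiniteType (A.X.left.presheaf.stalk (F.base (origin A))) (stalkOrigin A) :=
    LocallyOfFiniteType.stalkMap F (origin A)
  exact Algebra.FormallyUnramified.of_map_maximalIdeal H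

variable {f} in
/-- `[n]_A` is quasi-finite at the origin for `n` invertible in `K`: its stalk map is formally
unramified and essentially of finite type (Mathlib instance, `RingTheory.Unramified.LocalStructure`).
[folklore] -/
theorem quasiFiniteAt_origin (h : cotangentMap_zsmul_id A) (n : ℤ) (hn : (n : K) ≠ 0) :
    (Hom.toSchemeHom (n • 𝟙 A)).QuasiFiniteAt (origin A) := by
  set F := Hom.toSchemeHom (n • 𝟙 A)
  have h1 := formallyUnramified_stalkMap_origin h n hn
  have h2 : (F.stalkMap (origin A)).hom.EssFiniteType := LocallyOfFiniteType.stalkMap F _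
  algebraize [(F.stalkMap (origin A)).hom]
  haveI : Algebra.EssFiniteType _ _ := h2
  haveI : Algebra.FormallyUnramified _ _ := h1
  change Algebra.QuasiFinite _ _
  infer_instance

variable {f} in
/-- **The origin is an isolated point of `A[n]`** for `n` invertible in `K`: `[n]` is quasi-finite
at `e`, so `e` is open in the fibre `[n]⁻¹(e)` (Mathlib
`Scheme.Hom.quasiFiniteAt_iff_isOpen_singleton_asFiber`), which is the image of the embedding
`A[n] → A`. [folklore] -/
theorem isOpen_kerOrigin (h : cotangentMap_zsmul_id A) (n : ℤ) (hn : (n : K) ≠ 0) :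
    IsOpen ({Hom.kerOrigin (n • 𝟙 A)} : Set ↥(Hom.ker (n • 𝟙 A))) := by
  set F := Hom.toSchemeHom (n • 𝟙 A)
  have h1 : IsOpen ({F.asFiber (origin A)} : Set ↥(F.fiber (F.base (origin A)))) :=
    Scheme.Hom.quasiFiniteAt_iff_isOpen_singleton_asFiber.mp (quasiFiniteAt_origin h n hn)
  obtain ⟨W, hW, hWeq⟩ :=
    (F.fiberι (F.base (origin A))).isEmbedding.isInducing.isOpen_iff.mp h1
  have he : F.base (origin A) = origin A := toSchemeHom_origin _
  have hconv : (Hom.kerι (n • 𝟙 A)).base ⁻¹' W = {Hom.kerOrigin (n • 𝟙 A)} := by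
    ext k
    constructor
    · intro hk
      have hr : (Hom.kerι (n • 𝟙 A)).base k ∈ Set.range (F.fiberι (F.base (origin A))) := by
        rw [Scheme.Hom.range_fiberι, he, ← Hom.range_kerι]
        exact Set.mem_range_self k
      obtain ⟨z, hz⟩ := hr
      have hz' : z ∈ (F.fiberι (F.base (origin A))).base ⁻¹' W := by
        change (F.fiberι _).base z ∈ W
        rw [hz]
        exact hk
      rw [hWeq, Set.mem_singleton_iff] at hz'
      subst hz'
      rw [Set.mem_singleton_iff]
      apply (Hom.kerι (n • 𝟙 A)).isClosedEmbedding.injective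
      rw [Hom.kerι_kerOrigin, ← hz, Scheme.Hom.fiberι_asFiber]
    · rintro rfl
      change (Hom.kerι (n • 𝟙 A)).base (Hom.kerOrigin (n • 𝟙 A)) ∈ W
      rw [Hom.kerι_kerOrigin, ← F.fiberι_asFiber (origin A)]
      have : F.asFiber (origin A) ∈ (F.fiberι (F.base (origin A))).base ⁻¹' W := by
        rw [hWeq]; rfl
      exact this
  rw [← hconv]
  exact hW.preimage (Hom.kerι (n • 𝟙 A)).continuous

variable {f} in
/-- The unit point `Spec K → A[n]` is an open embedding of topological spaces for `n` invertible
in `K`. [folklore] -/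
theorem isOpenEmbedding_kerUnit (h : cotangentMap_zsmul_id A) (n : ℤ) (hn : (n : K) ≠ 0) :
    Topology.IsOpenEmbedding (Hom.kerUnit (n • 𝟙 A)).base := by
  refine .of_continuous_injective_isOpenMap (Scheme.Hom.continuous _)
    (fun p q _ => (eq_specPt K p).trans (eq_specPt K q).symm) ?_
  intro U hU
  rcases U.eq_empty_or_nonempty with rfl | ⟨p, hp⟩
  · simp
  · have : (Hom.kerUnit (n • 𝟙 A)).base '' U = {Hom.kerOrigin (n • 𝟙 A)} := by
      ext k
      simp only [Set.mem_image, Set.mem_singleton_iff]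
      constructor
      · rintro ⟨q, -, rfl⟩
        rw [eq_specPt K q]
      · rintro rfl
        exact ⟨p, hp, by rw [eq_specPt K p]⟩
    rw [this]
    exact isOpen_kerOrigin h n hn

variable {f} in
/-- **The unit point `Spec K → A[n]` is an open immersion** for `n` invertible in `K`, i.e. `A[n]`
is étale over `K` at the origin (Görtz–Wedhorn II, Prop. 27.187: `X[n]` is finite étale; Mathlib
`IsOpenImmersion.of_isIso_stalkMap`). [cite: GortzWedhorn2023, Prop. 27.187] -/
theorem isOpenImmersion_kerUnit (h : cotangentMap_zsmul_id A) (n : ℤ) (hn : (n : K) ≠ 0) :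
    IsOpenImmersion (Hom.kerUnit (n • 𝟙 A)) :=
  haveI := fun p => isIso_stalkMap_kerUnit h n hn p
  IsOpenImmersion.of_isIso_stalkMap _ (isOpenEmbedding_kerUnit h n hn)

/-! ### The diagonal of `[n]` and unramifiedness -/

/-- The section `a ↦ (a, e)` of `A ×_K Ker f → A` (the target written `A ×_{𝟙 ≫ hom} Ker f` to
match `transIso`). [folklore] -/
def Hom.unitSection : A.X.left ⟶ pullback (𝟙 _ ≫ A.X.hom) (Hom.kerToSpec f) :=
  pullback.lift (𝟙 _) (A.X.hom ≫ Hom.kerUnit f) (by simp)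

/-- First component of `unitSection`. [folklore] -/
@[reassoc (attr := simp)]
theorem Hom.unitSection_fst : Hom.unitSection f ≫ pullback.fst _ _ = 𝟙 _ :=
  pullback.lift_fst _ _ _

/-- Second component of `unitSection`. [folklore] -/
@[reassoc (attr := simp)]
theorem Hom.unitSection_snd : Hom.unitSection f ≫ pullback.snd _ _ = A.X.hom ≫ Hom.kerUnit f :=
  pullback.lift_snd _ _ _

/-- The section `a ↦ (a, e)` is the base change of the unit point `Spec K → Ker f` along the
projection `A ×_K Ker f → Ker f`. [folklore] -/
theorem Hom.isPullback_unitSection :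
    IsPullback (Hom.unitSection f) A.X.hom (pullback.snd _ _) (Hom.kerUnit f) := by
  have hc : pullback.fst (𝟙 _ ≫ A.X.hom) (Hom.kerToSpec f) ≫ A.X.hom =
      pullback.snd _ _ ≫ Hom.kerToSpec f := by
    rw [← pullback.condition, Category.id_comp]
  have hs : ∀ s : PullbackCone (pullback.snd (𝟙 _ ≫ A.X.hom) (Hom.kerToSpec f)) (Hom.kerUnit f),
      (s.fst ≫ pullback.fst _ _) ≫ A.X.hom = s.snd := fun s => by
    rw [Category.assoc, hc, ← Category.assoc, s.condition, Category.assoc, Hom.kerUnit_kerToSpec,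
      Category.comp_id]
  refine IsPullback.of_isLimit' ⟨by simp⟩ (PullbackCone.IsLimit.mk _
    (fun s => s.fst ≫ pullback.fst _ _) (fun s => ?_) (fun s => hs s) (fun s m hm _ => ?_))
  · refine pullback.hom_ext ?_ ?_
    · rw [Category.assoc, Hom.unitSection_fst, Category.comp_id]
    · rw [Category.assoc, Hom.unitSection_snd, ← Category.assoc, hs s, s.condition]
  · rw [← hm, Category.assoc, Hom.unitSection_fst, Category.comp_id]

/-- `x⁻¹ x = e` for a scheme-valued point `x` of `A`. [folklore] -/
theorem divPt_self {Z : Scheme.{u}} (x : Z ⟶ A.X.left) (hx : x ≫ A.X.hom = x ≫ A.X.hom) :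
    divPt x x hx = (x ≫ A.X.hom) ≫ unitPt A := by
  have h : ptOf' x x hx = ptOf x := Over.OverMorphism.ext rfl
  change ((ptOf x)⁻¹ * ptOf' x x hx).left = _
  rw [h, inv_mul_cancel]
  rfl

/-- **The diagonal of `f` is the section `a ↦ (a, e)` under the shear isomorphism**
`A ×_{f, B, f} A ≅ A ×_K Ker f`, `(a, b) ↦ (b, b⁻¹ a)` (`transIso` of `AVIsogenyFlat`;
Görtz–Wedhorn II, (27.9.1)). [folklore] -/
theorem Hom.diagonal_comp_transIso_hom :
    pullback.diagonal (Hom.toSchemeHom f) ≫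
      (transIso f (Hom.toSchemeHom f) (𝟙 _) (Category.id_comp _)).hom = Hom.unitSection f := by
  refine pullback.hom_ext ?_ (pullback.hom_ext ?_ ?_)
  · rw [Category.assoc, transIso_hom_fst, pullback.diagonal_snd, Hom.unitSection_fst]
  · simp only [Category.assoc]
    rw [Hom.unitSection_snd_assoc, Hom.kerUnit_kerι]
    change pullback.diagonal (Hom.toSchemeHom f) ≫
      transHom f _ _ (Category.id_comp _) ≫ pullback.snd _ _ ≫ Hom.kerι f = _
    rw [transHom_snd_kerι, comp_divPt _ _ _ _ (x' := 𝟙 _) (b' := 𝟙 _)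
      (by rw [Category.comp_id, pullback.diagonal_snd]) (pullback.diagonal_fst _) rfl,
      divPt_self, Category.id_comp]
  · simp only [Category.assoc]
    rw [Hom.unitSection_snd_assoc, Hom.kerUnit_kerToSpec, Category.comp_id]
    change pullback.diagonal (Hom.toSchemeHom f) ≫
      transHom f _ _ (Category.id_comp _) ≫ pullback.snd _ _ ≫ Hom.kerToSpec f = _
    rw [transHom_snd_kerToSpec, pullback.diagonal_snd_assoc, Category.id_comp]

variable {f} in
/-- **`[n]_A` is unramified for `n` invertible in `K`** (given `Lie([n]) = n`): its diagonal is,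
up to the shear isomorphism, the base change `a ↦ (a, e)` of the open immersion `Spec K → A[n]`,
hence an open immersion, and a morphism whose diagonal is an open immersion is formally unramified
(Mathlib instance). This replaces the homogeneity argument of Görtz–Wedhorn II, proof of
Prop. 27.187 (translations by points over an algebraic closure). [cite: GortzWedhorn2023, Prop. 27.187] -/
theorem formallyUnramified_zsmul_id (h : cotangentMap_zsmul_id A) (n : ℤ) (hn : (n : K) ≠ 0) :
    FormallyUnramified (Hom.toSchemeHom (n • 𝟙 A)) := by
  haveI := isOpenImmersion_kerUnit h n hn
  haveI : IsOpenImmersion (Hom.unitSection (n • 𝟙 A)) :=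
    MorphismProperty.of_isPullback (Hom.isPullback_unitSection (n • 𝟙 A)).flip ‹_›
  have heq : pullback.diagonal (Hom.toSchemeHom (n • 𝟙 A)) = Hom.unitSection (n • 𝟙 A) ≫
      (transIso (n • 𝟙 A) (Hom.toSchemeHom (n • 𝟙 A)) (𝟙 _) (Category.id_comp _)).inv := by
    rw [← Hom.diagonal_comp_transIso_hom, Category.assoc, Iso.hom_inv_id, Category.comp_id]
  haveI : IsOpenImmersion (pullback.diagonal (Hom.toSchemeHom (n • 𝟙 A))) := by
    rw [heq]; infer_instance
  infer_instance

end Kernel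

/-! ### Conclusion: `[n]_A` is étale -/

omit [Field K] in
/-- Unramified morphisms locally of finite type are locally quasi-finite (affine-locally the Mathlib
instance "formally unramified and essentially of finite type implies quasi-finite",
`Mathlib.RingTheory.Unramified.LocalStructure`). It subsumes `Literature.AlgebraicGeometry.Motives.locallyQuasiFinite_of_etale` of
`AbelianVarietyTorsion` (étale morphisms are formally unramified and locally of finite type), which
can be retired in its favour. [folklore] -/
theorem _root_.Literature.AlgebraicGeometry.Motives.locallyQuasiFinite_of_formallyUnramified {X Y : Scheme.{u}} (g : X ⟶ Y)
    [FormallyUnramified g] [LocallyOfFiniteType g] : LocallyQuasiFinite g := by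
  rw [HasRingHomProperty.iff_appLE (P := @LocallyQuasiFinite)]
  intro U V e
  have h1 : (g.appLE U V e).hom.FormallyUnramified :=
    HasRingHomProperty.appLE (P := @FormallyUnramified) g inferInstance U V e
  have h2 : (g.appLE U V e).hom.FiniteType :=
    HasRingHomProperty.appLE (P := @LocallyOfFiniteType) g inferInstance U V e
  algebraize [(g.appLE U V e).hom]
  change Algebra.QuasiFinite _ _
  infer_instance

/-- **`[n]_A` is an isogeny for `n` invertible in `K`** (given `Lie([n]) = n`): surjective
(`surjective_zsmul_id`) and finite — unramified, hence locally quasi-finite, and proper (Zariski's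
main theorem, Mathlib `IsFinite.of_isProper_of_locallyQuasiFinite`). This is the first assertion of
Görtz–Wedhorn II, Prop. 27.186 for `n` invertible in `K`, i.e. the named fact `isIsogeny_zsmul_id A`
restricted to such `n`, and the finiteness assertion of Prop. 27.187.
[cite: GortzWedhorn2023, Prop. 27.187] -/
theorem isIsogeny_zsmul_id_of_cotangentMap (h : cotangentMap_zsmul_id A) (n : ℤ)
    (hn : (n : K) ≠ 0) : IsIsogeny (n • 𝟙 A) := by
  haveI := formallyUnramified_zsmul_id h n hn
  haveI : LocallyQuasiFinite (Hom.toSchemeHom (n • 𝟙 A)) :=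
    locallyQuasiFinite_of_formallyUnramified _
  haveI := isProper_toSchemeHom (n • 𝟙 A)
  exact ⟨surjective_zsmul_id h n hn, IsFinite.of_isProper_of_locallyQuasiFinite _⟩

/-- **`[n]_A` is étale for `n` invertible in `K`, from `Lie([n]_A) = n`**: the named fact
`etale_zsmul_id A` (Görtz–Wedhorn II, Prop. 27.187) follows from `cotangentMap_zsmul_id A`.
Unramified by `formallyUnramified_zsmul_id`, flat as an isogeny (`isIsogeny_zsmul_id_of_cotangentMap`
and `IsIsogeny.flat` of `AVIsogenyFlat`), and locally of finite presentation (Mathlib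
`Etale.of_formallyUnramified_of_flat`). [cite: GortzWedhorn2023, Prop. 27.187] -/
theorem etale_zsmul_id_of_cotangentMap (h : cotangentMap_zsmul_id A) : etale_zsmul_id A := by
  intro n hn
  haveI := formallyUnramified_zsmul_id h n hn
  haveI : Flat (Hom.toSchemeHom (n • 𝟙 A)) := (isIsogeny_zsmul_id_of_cotangentMap h n hn).flat
  haveI : LocallyOfFinitePresentation (Hom.toSchemeHom (n • 𝟙 A)) :=
    LocallyOfFinitePresentation.iff_locallyOfFiniteType.mpr inferInstance
  exact Etale.of_formallyUnramified_of_flat _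

/-- **Torsion points from `deg [n] = n^{2g}` and `Lie([n]) = n`.** The named fact
`natCard_torsionPoints_of_isAlgClosed A L` (`#A[n](L) = n^{2g}` for `L ⊇ K` algebraically closed and
`n` invertible in `K`; Görtz–Wedhorn II, Prop. 27.188 (1); Mumford, *Abelian Varieties*, §6,
Application 3, Proposition p. 64) follows from `kerRank_zsmul_id A` (Prop. 27.186, theorem of the
cube) and `cotangentMap_zsmul_id A` (`Lie([n]) = n`): combine
`natCard_torsionPoints_of_isAlgClosed_of` with `etale_zsmul_id_of_cotangentMap`.
[cite: GortzWedhorn2023, Prop. 27.188 (1)] -/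
theorem natCard_torsionPoints_of_isAlgClosed_of_cotangentMap (L : Type u) [Field L] [Algebra K L]
    (h₂ : kerRank_zsmul_id A) (hL : cotangentMap_zsmul_id A) :
    natCard_torsionPoints_of_isAlgClosed A L :=
  natCard_torsionPoints_of_isAlgClosed_of A L h₂ (etale_zsmul_id_of_cotangentMap hL)

end AbelianVariety

end Literature.AlgebraicGeometry.Motives

end
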